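import Summits.QuantumFields.BalabanUV.Beta.SymCorrectorTransport
import Summits.QuantumFields.BalabanUV.Beta.D1BFx.ChartDefectResolvent
import Summits.QuantumFields.BalabanUV.Beta.D1BFx.BlockMeanBlindnessLegs

/-!
# `BalabanUV.Beta.D1BFx.ChartDefectCorrectorWords` — road «BF-x», binder row D1, PART 24-hyb HEAD RE-PAIRED, the OWNER's leg (c2):
# **THE ALPHABET OF THE (lead) ROW — the nilpotent part `E := Ψ̂_S − 1` of the symmetrised corrector, the slice projector on it,
# and `Dsh`, `GcombSh n 0` as `E`-WORDS** (`REPAIR-SPEC-g26.md` §4 (ii)∕(iii) typed).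

WHAT IT TYPES ([folklore] kernel bookkeeping over landed letters BY NAME; `E` is never a definition — it is the displayed difference
`psiKS r n − idK` of `SymCorrectorKernel.psiKS` and the Kronecker kernel).
§1 ENTRIES.  `E` is field–field only; its `(x,inl α),(y,inl β)` entry is the COARSE GRADIENT across the bond `[x, x+e_α]` of the symmetrised
   block potential `ζ_S` of the input bond indicator `e_{(β,y)}`, scaled by `|box n|⁻¹` (`SymCorrectorForms.corrPsiS_apply`); hence every
   INTRA-BLOCK row of `E` vanishes (`E` writes FACE bonds only), and `Φ̂_S = idK − E` (`corrPhiS_apply`).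
§2 ALGEBRA.  `E` is spread; `Ψ̂_S = idK + E`, `Φ̂_S = idK − E`; **`E∘E = 0`** (from `Ψ̂_S∘Φ̂_S = idK`); the slice projector is IDEMPOTENT,
   `axEc∘axEc = axEc`, and is THE IDENTITY ON THE RANGE OF `E`: **`axEc ρ n ∘ E = E`** for EVERY root `ρ` (face bonds are never comb bonds) —
   so the slice rule `(axEc∘Ψ̂_S)∘axEc = Ψ̂_S∘axEc` of `SymCorrectorKernel` is its corollary, while `E∘axEc ≠ E` is NOT claimed (the corrector
   READS comb bonds); the slice-internal corrector `Ẽ := E∘axEc` satisfies `axEc∘Ẽ = Ẽ = Ẽ∘axEc` and `Ẽ∘Ẽ = 0`.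
§3 THE TWO PINS AS `E`-WORDS (centre root `ctrOff (d+1) n`).  From `SymCorrectorTransport.trK_phiKS_bhK_phiKS_eq_bhK_add_Dsh`:
   **`Dsh n = −Eᵀ∘bhK n − bhK n∘E + Eᵀ∘bhK n∘E`**; from `GcombSh_zero_eq_conj_psiKS_KInvStep`:
   **`GcombSh n 0 = G₀ + E∘G₀ + G₀∘Eᵀ + E∘G₀∘Eᵀ`**, `G₀ := coDressKBmAt ρ_c n (KInvStep n 0)`; and since `G₀ = axEc∘G₀ = G₀∘axEc`
   (`ChartDefectResolvent.relInv_G0bm_ctr`) ONLY THE SLICE-INTERNAL CORRECTOR MEETS THE ROAD's KERNEL: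
   `E∘G₀ = Ẽ∘G₀`, `G₀∘Eᵀ = G₀∘Ẽᵀ`, **`GcombSh n 0 = (idK + Ẽ)∘G₀∘(idK + Ẽ)ᵀ`**.
WHAT IT ANSWERS (`REPAIR-SPEC-g26.md` §4 (iii), located): `axEc` does NOT annihilate any part of `E`'s output — the output is face-supported and
the slice projector is the identity there; what the relative inverse does is restrict `E`'s INPUT to the slice (`Ẽ = E∘axEc`: in-block NON-comb
bonds in, face bonds out).  The conjugation-defect words of `ChartDefectRepair.conjDefect_words` ∕ `ChartDefectLeadRecord.conj_sub_eq_three_words`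
may therefore be read with `Ẽ` for `E`; no word is priced here.

HONEST DEPENDENCY (cell records, verbatim): «continuum YM on T⁴ ⇐ BetaPertH ∧ nine spine estimates (0/9 proved); BetaPertH ⇐ (D1) ∧ (D4) ∧
CAP+tail; G-an2-4 gates asym, D1 and NE2/3/4.»  HONEST FRAMING (cell contract, verbatim): «discharging `BetaPertH` makes Bałaban's UV stability
UNCONDITIONAL — a real constructive-QFT result; it is NOT the continuum limit and NOT the Clay problem.»  THIS MODULE DISCHARGES NOTHING of the wall:
[folklore] finite-sum ∕ tame-kernel algebra over `SymCorrectorKernel`, `SymCorrectorForms`, `SymCorrectorTransport`, `AxialDressingRooted.axEc`,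
`ChartDefectResolvent`, `BlockMeanBlindnessLegs.spr_sub` BY NAME; it prices NO row and asserts NO n-law.  No definition, no `def … : Prop`, nothing cited, 0 sorry, default heartbeats.
0∕4 row-D1 binders; (K) NOT closed; (J1) ONE OPEN ROW; NOT D1, NEVER «G-an2-4 closed», NOT `BetaPertH`, NOT continuum, NOT Clay.

ABSOLUTE RULE (cell charter, verbatim): «No internally-minted statement may enter as a cited fact. Every hypothesis is either kernel-proved in this
package or a verbatim quotation of a PUBLISHED theorem with page reference. The manuscript(s) under audit are NOT citable for their own disputed
steps — they are the thing under adjudication; programme-internal (2001/route/tribunal) claims are never citable.»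

Unit `b2b-balaban-beta-d1-p2` (road owner, gen 27), 2026-08-24; over `SymCorrectorKernel` ∕ `SymCorrectorForms` ∕ `SymCorrectorTransport` (leaf-03 g28),
`ChartDefectResolvent` (gen 22) BY NAME; no existing file touched.
-/

noncomputable section

namespace Summit.QuantumFields.BalabanUV.Beta.D1BFx.ChartDefectCorrectorWords

open Finset
open scoped BigOperators
open Literature.Probability.LatticeModels (Torus.proj)
open Literature.MathematicalPhysics.QuantumFieldTheory
open Literature.MathematicalPhysics.QuantumFieldTheory.Balaban1983to89
open Literature.MathematicalPhysics.QuantumFieldTheory.Balaban1983to89.Beta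
open ExpKernelCalculus (MKer comp)
open HessKerSchurResolvent (idK idK_apply comp_idK_left comp_idK_right)
open OneStepResolventKernel (Fib)
open OneStepKernelFamily (KInvStep)
open AffineAveraging (Site Form1 box toSite unitVec)
open AveragingContours (blk)
open AveragingContoursRooted (ctr ctrOff ctrOff_mem_box)
open Summit.QuantumFields.BalabanUV.Beta.TameKernelCalculus
open Summit.QuantumFields.BalabanUV.Beta.ChartConjugationRelative (RelInv spr_comp)
open Summit.QuantumFields.BalabanUV.Beta.RelInvCongruenceKernel (trK_idK)
open Summit.QuantumFields.BalabanUV.Beta.RelInvNullShift (spr_add)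
open Summit.QuantumFields.BalabanUV.Beta.AxialDressingRooted (IsCombBondAt axEc axEc_inl_inl axEc_inl_inr axEc_inr_inl axEc_inr_inr spr_axEc
  trK_axEc comp_axEc_apply coDressKBmAt)
open Summit.QuantumFields.BalabanUV.Beta.BorderedHessian (bhK spr_bhK)
open Summit.QuantumFields.BalabanUV.Beta.DshAn1 (Dsh)
open Summit.QuantumFields.BalabanUV.Beta.CombChartStepJets (GcombSh)
open Summit.QuantumFields.BalabanUV.Beta.CompositeCorrectorKernel (indR indR_apply)
open Summit.QuantumFields.BalabanUV.Beta.SymCorrectorForms (zetaS corrPsiS corrPhiS corrPsiS_apply corrPhiS_apply)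
open Summit.QuantumFields.BalabanUV.Beta.SymCorrectorKernel (psiKS phiKS psiKS_inl_inl psiKS_inl_inr psiKS_inr_inl psiKS_inr_inr phiKS_inl_inl
  phiKS_inl_inr phiKS_inr_inl phiKS_inr_inr spr_psiKS spr_phiKS comp_psiKS_phiKS)
open Summit.QuantumFields.BalabanUV.Beta.SymCorrectorTransport (trK_phiKS_bhK_phiKS_eq_bhK_add_Dsh GcombSh_zero_eq_conj_psiKS_KInvStep)
open Summit.QuantumFields.BalabanUV.Beta.D1BFx.ChartDefectResolvent (relInv_G0bm_ctr spr_G0bm_ctr)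
open Summit.QuantumFields.BalabanUV.Beta.D1BFx.BlockMeanBlindnessLegs (spr_sub)

variable {d : ℕ}

/-! ## §1 The entries of `E := Ψ̂_S − idK` -/

section Entries

variable (r : Fin (d + 1) → ℕ) (n : ℕ) (x y : Site (d + 1))

/-- [folklore] On the field–field block the Kronecker kernel IS the bond indicator: `idK x y (inl α) (inl β) = e_{(β,y)} α x`. -/
theorem idK_inl_inl_eq_indR (α β : Fin (d + 1)) : (idK : MKer (d + 1) (Fib d)) x y (Sum.inl α) (Sum.inl β) = indR β y α x := by
  rw [idK_apply, indR_apply]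
  by_cases h : x = y ∧ α = β
  · rw [if_pos ⟨h.1, congrArg Sum.inl h.2⟩, if_pos ⟨h.2, h.1⟩]
  · rw [if_neg (fun h' => h ⟨h'.1, Sum.inl_injective h'.2⟩), if_neg (fun h' => h ⟨h'.2, h'.1⟩)]

/-- [folklore] **FIELD–FIELD ENTRY OF `E`**: the coarse gradient across `[x, x + e_α]` of the symmetrised block potential of the input bond,
`E x y (inl α) (inl β) = |box n|⁻¹ · (ζ_S e_{(β,y)} (blk (x + e_α)) − ζ_S e_{(β,y)} (blk x))` (`corrPsiS_apply`). -/
theorem E_inl_inl (α β : Fin (d + 1)) :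
    (psiKS r n - idK : MKer (d + 1) (Fib d)) x y (Sum.inl α) (Sum.inl β)
      = ((box (d + 1) n).card : ℝ)⁻¹
          * (zetaS (toSite r) n (indR β y) (blk n (x + unitVec α)) - zetaS (toSite r) n (indR β y) (blk n x)) := by
  show psiKS r n x y (Sum.inl α) (Sum.inl β) - idK x y (Sum.inl α) (Sum.inl β) = _
  rw [idK_inl_inl_eq_indR, psiKS_inl_inl, corrPsiS_apply]
  ring

/-- [folklore] Field–multiplier entry of `E` vanishes. -/
theorem E_inl_inr (α μ : Fin (d + 1)) : (psiKS r n - idK : MKer (d + 1) (Fib d)) x y (Sum.inl α) (Sum.inr μ) = 0 := by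
  show psiKS r n x y (Sum.inl α) (Sum.inr μ) - idK x y (Sum.inl α) (Sum.inr μ) = 0
  rw [psiKS_inl_inr, idK_apply, if_neg (fun h => Sum.inl_ne_inr h.2), sub_zero]

/-- [folklore] **THE MULTIPLIER ROWS OF `E` VANISH** (the corrector's multiplier block is the identity). -/
theorem E_inr (μ : Fin (d + 1)) (b : Fib d) : (psiKS r n - idK : MKer (d + 1) (Fib d)) x y (Sum.inr μ) b = 0 := by
  show psiKS r n x y (Sum.inr μ) b - idK x y (Sum.inr μ) b = 0
  rcases b with β | μ'
  · rw [psiKS_inr_inl, idK_apply, if_neg (fun h => Sum.inr_ne_inl h.2), sub_zero]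
  · rw [psiKS_inr_inr, idK_apply]
    by_cases h : x = y ∧ μ = μ'
    · rw [if_pos h, if_pos ⟨h.1, congrArg Sum.inr h.2⟩, sub_self]
    · rw [if_neg h, if_neg (fun h' => h ⟨h'.1, Sum.inr_injective h'.2⟩), sub_self]

/-- [folklore] **THE MULTIPLIER COLUMNS OF `E` VANISH.** -/
theorem E_inr_right (a : Fib d) (μ : Fin (d + 1)) : (psiKS r n - idK : MKer (d + 1) (Fib d)) x y a (Sum.inr μ) = 0 := by
  rcases a with α | m
  · exact E_inl_inr r n x y α μ
  · exact E_inr r n x y m _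

/-- [folklore] **`E` WRITES FACE BONDS ONLY**: every INTRA-BLOCK row vanishes — `blk (x + e_α) = blk x ⟹ E x y (inl α) b = 0`. -/
theorem E_inl_eq_zero_of_blk_eq {x} {α : Fin (d + 1)} (hx : blk n (x + unitVec α) = blk n x) (b : Fib d) :
    (psiKS r n - idK : MKer (d + 1) (Fib d)) x y (Sum.inl α) b = 0 := by
  rcases b with β | μ
  · rw [E_inl_inl, hx, sub_self, mul_zero]
  · exact E_inl_inr r n x y α μ

/-- [folklore] In particular `E` has NO COMB ROWS, for ANY root `ρ` (a comb bond is intra-block: `IsCombBondAt.2`). -/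
theorem E_inl_eq_zero_of_isCombBond (ρ : Fin (d + 1) → ℤ) {x} {α : Fin (d + 1)} (hx : IsCombBondAt ρ n α x) (b : Fib d) :
    (psiKS r n - idK : MKer (d + 1) (Fib d)) x y (Sum.inl α) b = 0 :=
  E_inl_eq_zero_of_blk_eq r n y hx.2 b

/-- [folklore] **`Φ̂_S = idK − E`** (`Φ_S A = A − |box|⁻¹•dz (ext (ζ_S A))`, `Ψ_S A = A + |box|⁻¹•dz (ext (ζ_S A))`): entrywise. -/
theorem phiKS_eq_idK_sub_E : phiKS r n = idK - (psiKS r n - idK) := by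
  funext x y a b
  show phiKS r n x y a b = idK x y a b - (psiKS r n x y a b - idK x y a b)
  rcases a with α | μ <;> rcases b with β | μ'
  · rw [idK_inl_inl_eq_indR, phiKS_inl_inl, psiKS_inl_inl, corrPhiS_apply, corrPsiS_apply]
    ring
  · rw [phiKS_inl_inr, psiKS_inl_inr, idK_apply, if_neg (fun h => Sum.inl_ne_inr h.2)]
    ring
  · rw [phiKS_inr_inl, psiKS_inr_inl, idK_apply, if_neg (fun h => Sum.inr_ne_inl h.2)]
    ring
  · rw [phiKS_inr_inr, psiKS_inr_inr, idK_apply]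
    by_cases h : x = y ∧ μ = μ'
    · rw [if_pos h, if_pos ⟨h.1, congrArg Sum.inr h.2⟩]
      ring
    · rw [if_neg h, if_neg (fun h' => h ⟨h'.1, Sum.inr_injective h'.2⟩)]
      ring

/-- [folklore] `Ψ̂_S = idK + E` (tautology, displayed for the word lists). -/
theorem psiKS_eq_idK_add_E : psiKS r n = idK + (psiKS r n - idK) := by
  abel

end Entries

/-! ## §2 Algebra: `E` spread and nilpotent; the slice projector on `E` -/

section Algebra

variable {n : ℕ} (hn : 0 < n) {r : Fin (d + 1) → ℕ} (hr : r ∈ box (d + 1) n)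

include hn hr

/-- [folklore] **`E` IS SPREAD.** -/
theorem spr_E : Spr (psiKS r n - idK) := spr_sub (spr_psiKS hn hr) spr_idK

/-- [folklore] **NILPOTENCY `E∘E = 0`** — from `Ψ̂_S ∘ Φ̂_S = idK` (`SymCorrectorKernel.comp_psiKS_phiKS`) with `Ψ̂_S = idK + E`, `Φ̂_S = idK − E`:
`(idK + E)∘(idK − E) = idK − E∘E`.  (Form level: `ζ_S ∘ dz ∘ ext = 0`, `SymCorrectorForms.zetaS_dz_ext`.) -/
theorem comp_E_E : comp (psiKS r n - idK) (psiKS r n - idK) = 0 := by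
  set E : MKer (d + 1) (Fib d) := psiKS r n - idK with hE
  have hI : Tame (idK : MKer (d + 1) (Fib d)) := spr_idK.tame
  have hEt : Tame E := (spr_E hn hr).tame
  have hψ : psiKS r n = idK + E := psiKS_eq_idK_add_E r n
  have hφ : phiKS r n = idK - E := phiKS_eq_idK_sub_E r n
  have h := comp_psiKS_phiKS hn hr
  rw [hψ, comp_add_left_tame hI hEt (spr_phiKS hn hr).tame, comp_idK_left, hφ, comp_sub_right_tame hEt hI hEt,
    comp_idK_right] at h
  -- `h : idK - E + (E - E∘E) = idK`
  calc comp E E = idK - (idK - E + (E - comp E E)) := by abel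
    _ = 0 := by rw [h, sub_self]

omit hn hr in
open Classical in
/-- [folklore] **THE SLICE PROJECTOR IS IDEMPOTENT**: `axEc ρ N ∘ axEc ρ N = axEc ρ N`. -/
theorem comp_axEc_axEc (ρ : Fin (d + 1) → ℤ) (N : ℕ) : comp (axEc ρ N) (axEc ρ N) = axEc (d := d) ρ N := by
  funext x z a b
  rw [comp_axEc_apply]
  rcases a with α | m
  · show (if IsCombBondAt ρ N α x then 0 else axEc ρ N x z (Sum.inl α) b) = _
    by_cases hc : IsCombBondAt ρ N α x
    · rw [if_pos hc]
      rcases b with β | m'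
      · rw [axEc_inl_inl, if_neg (fun h => h.2.2 hc)]
      · rw [axEc_inl_inr]
    · rw [if_neg hc]
  · show (if Torus.proj N x = 0 then axEc ρ N x z (Sum.inr m) b else 0) = _
    by_cases hp : Torus.proj N x = 0
    · rw [if_pos hp]
    · rw [if_neg hp]
      rcases b with β | m'
      · rw [axEc_inr_inl]
      · rw [axEc_inr_inr, if_neg (fun h => hp h.2.2)]

omit hn hr in
open Classical in
/-- [folklore] **THE SLICE PROJECTOR IS THE IDENTITY ON THE RANGE OF `E`**: `axEc ρ N ∘ E = E` for EVERY root `ρ` and every corrector root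
offset `r` — `E` has no comb rows (§1) and no multiplier rows.  (`E ∘ axEc ρ N ≠ E` in general: the corrector READS comb bonds; not claimed.) -/
theorem comp_axEc_E (ρ : Fin (d + 1) → ℤ) (r : Fin (d + 1) → ℕ) (N : ℕ) :
    comp (axEc ρ N) (psiKS r N - idK) = psiKS r N - idK := by
  funext x z a b
  rw [comp_axEc_apply]
  rcases a with α | m
  · show (if IsCombBondAt ρ N α x then 0 else (psiKS r N - idK : MKer (d + 1) (Fib d)) x z (Sum.inl α) b) = _
    by_cases hc : IsCombBondAt ρ N α x
    · rw [if_pos hc, E_inl_eq_zero_of_isCombBond r N z ρ hc b]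
    · rw [if_neg hc]
  · show (if Torus.proj N x = 0 then (psiKS r N - idK : MKer (d + 1) (Fib d)) x z (Sum.inr m) b else 0) = _
    rw [E_inr]
    split_ifs <;> rfl

omit hn hr in
/-- [folklore] … and on the range of `Eᵀ` from the right: `Eᵀ ∘ axEc ρ N = Eᵀ` (`trK_axEc`, `trK_comp`). -/
theorem comp_trK_E_axEc (ρ : Fin (d + 1) → ℤ) (r : Fin (d + 1) → ℕ) (N : ℕ) :
    comp (trK (psiKS r N - idK)) (axEc ρ N) = trK (psiKS r N - idK) := by
  have h := congrArg trK (comp_axEc_E (d := d) ρ r N)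
  rwa [trK_comp, trK_axEc] at h

/-- [folklore] **THE SLICE RULE OF `SymCorrectorKernel` AS A COROLLARY**: `(axEc∘Ψ̂_S)∘axEc = Ψ̂_S∘axEc` (any root `ρ`; here from `axEc∘E = E` and
idempotency, for comparison with `comp_comp_axEc_psiKS`, which asks `ρ = toSite s`, `s ∈ box`). -/
theorem comp_comp_axEc_psiKS' (ρ : Fin (d + 1) → ℤ) :
    comp (comp (axEc ρ n) (psiKS r n)) (axEc ρ n) = comp (psiKS r n) (axEc ρ n) := by
  have hI : Tame (idK : MKer (d + 1) (Fib d)) := spr_idK.tame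
  have hEt : Tame (psiKS r n - idK) := (spr_E hn hr).tame
  have hA : Tame (axEc (d := d) ρ n) := (spr_axEc ρ n).tame
  rw [psiKS_eq_idK_add_E r n, comp_add_right_tame hA hI hEt, comp_idK_right, comp_axEc_E,
    comp_add_left_tame hA hEt hA, comp_axEc_axEc, comp_add_left_tame hI hEt hA, comp_idK_left]

/-- [folklore] **THE SLICE-INTERNAL CORRECTOR `Ẽ := E ∘ axEc` COMMUTES WITH THE SLICE PROJECTOR (I)**: `axEc ∘ Ẽ = Ẽ`. -/
theorem comp_axEc_Etilde (ρ : Fin (d + 1) → ℤ) :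
    comp (axEc ρ n) (comp (psiKS r n - idK) (axEc ρ n)) = comp (psiKS r n - idK) (axEc ρ n) := by
  rw [comp_assoc_tame (spr_axEc ρ n).tame (spr_E hn hr).tame (spr_axEc ρ n).tame, comp_axEc_E]

/-- [folklore] **(II)**: `Ẽ ∘ axEc = Ẽ`. -/
theorem comp_Etilde_axEc (ρ : Fin (d + 1) → ℤ) :
    comp (comp (psiKS r n - idK) (axEc ρ n)) (axEc ρ n) = comp (psiKS r n - idK) (axEc ρ n) := by
  rw [← comp_assoc_tame (spr_E hn hr).tame (spr_axEc ρ n).tame (spr_axEc ρ n).tame, comp_axEc_axEc]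

/-- [folklore] **`Ẽ ∘ Ẽ = 0`.** -/
theorem comp_Etilde_Etilde (ρ : Fin (d + 1) → ℤ) :
    comp (comp (psiKS r n - idK) (axEc ρ n)) (comp (psiKS r n - idK) (axEc ρ n)) = 0 := by
  have hE : Tame (psiKS r n - idK) := (spr_E hn hr).tame
  have hA : Tame (axEc (d := d) ρ n) := (spr_axEc ρ n).tame
  have hEA : Tame (comp (psiKS r n - idK) (axEc ρ n)) := (spr_comp (spr_E hn hr) (spr_axEc ρ n)).tame
  rw [← comp_assoc_tame hE hA hEA, comp_axEc_Etilde hn hr ρ, comp_assoc_tame hE hE hA, comp_E_E hn hr]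
  funext x z a b
  show (∑' y, ∑ f, (0 : MKer (d + 1) (Fib d)) x y a f * axEc ρ n y z f b) = 0
  simp

end Algebra

/-! ## §3 The two pins as `E`-words (centre root) -/

section Pins

variable (n : ℕ) [NeZero n]

/-- [folklore] **`Dsh` IS AN `E`-WORD**: `Dsh n = −Eᵀ∘bhK n − bhK n∘E + Eᵀ∘bhK n∘E`, `E := psiKS (ctrOff (d+1) n) n − idK` — the bordered identity
`Φ̂_Sᵀ∘bhK∘Φ̂_S = bhK + Dsh` (`SymCorrectorTransport.trK_phiKS_bhK_phiKS_eq_bhK_add_Dsh`) with `Φ̂_S = idK − E`, expanded. -/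
theorem Dsh_eq_E_words :
    Dsh (d := d) n
      = -comp (trK (psiKS (ctrOff (d + 1) n) n - idK)) (bhK n) - comp (bhK n) (psiKS (ctrOff (d + 1) n) n - idK)
        + comp (comp (trK (psiKS (ctrOff (d + 1) n) n - idK)) (bhK n)) (psiKS (ctrOff (d + 1) n) n - idK) := by
  have hn : 0 < n := Nat.pos_of_ne_zero (NeZero.ne n)
  have hr : ctrOff (d + 1) n ∈ box (d + 1) n := ctrOff_mem_box hn
  set E : MKer (d + 1) (Fib d) := psiKS (ctrOff (d + 1) n) n - idK with hE
  have hI : Tame (idK : MKer (d + 1) (Fib d)) := spr_idK.tame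
  have hEs : Spr E := spr_E hn hr
  have hB : Spr (bhK (d := d) n) := spr_bhK hn
  have hTB : Spr (comp (trK E) (bhK n)) := spr_comp hEs.trK hB
  have h := trK_phiKS_bhK_phiKS_eq_bhK_add_Dsh (d := d) n
  rw [phiKS_eq_idK_sub_E, ← hE, trK_sub, trK_idK, comp_sub_left_tame hI hEs.trK.tame hB.tame, comp_idK_left,
    comp_sub_right_tame (spr_sub hB hTB).tame hI hEs.tame, comp_idK_right,
    comp_sub_left_tame hB.tame hTB.tame hEs.tame] at h
  -- `h : bhK − Eᵀ∘bhK − (bhK∘E − Eᵀ∘bhK∘E) = bhK + Dsh`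
  calc Dsh (d := d) n = (bhK n + Dsh n) - bhK n := by abel
    _ = _ := by rw [← h]; abel

/-- [folklore] **THE LITERAL KERNEL IS AN `E`-WORD**: `GcombSh n 0 = G₀ + E∘G₀ + G₀∘Eᵀ + E∘G₀∘Eᵀ`, `G₀ := coDressKBmAt ρ_c n (KInvStep n 0)`
(`SymCorrectorTransport.GcombSh_zero_eq_conj_psiKS_KInvStep` with `Ψ̂_S = idK + E`, expanded). -/
theorem GcombSh_zero_eq_E_words :
    GcombSh (d := d) n 0
      = coDressKBmAt (ctr (d + 1) n) n (KInvStep (d := d) n 0)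
        + comp (psiKS (ctrOff (d + 1) n) n - idK) (coDressKBmAt (ctr (d + 1) n) n (KInvStep (d := d) n 0))
        + comp (coDressKBmAt (ctr (d + 1) n) n (KInvStep (d := d) n 0)) (trK (psiKS (ctrOff (d + 1) n) n - idK))
        + comp (comp (psiKS (ctrOff (d + 1) n) n - idK) (coDressKBmAt (ctr (d + 1) n) n (KInvStep (d := d) n 0)))
            (trK (psiKS (ctrOff (d + 1) n) n - idK)) := by
  have hn : 0 < n := Nat.pos_of_ne_zero (NeZero.ne n)
  have hr : ctrOff (d + 1) n ∈ box (d + 1) n := ctrOff_mem_box hn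
  set E : MKer (d + 1) (Fib d) := psiKS (ctrOff (d + 1) n) n - idK with hE
  set G₀ : MKer (d + 1) (Fib d) := coDressKBmAt (ctr (d + 1) n) n (KInvStep (d := d) n 0) with hG₀
  have hI : Tame (idK : MKer (d + 1) (Fib d)) := spr_idK.tame
  have hEs : Spr E := spr_E hn hr
  have hG : Spr G₀ := spr_G0bm_ctr
  have hEG : Spr (comp E G₀) := spr_comp hEs hG
  rw [GcombSh_zero_eq_conj_psiKS_KInvStep n, ← hG₀, psiKS_eq_idK_add_E, ← hE, trK_add, trK_idK,
    comp_add_left_tame hI hEs.tame hG.tame, comp_idK_left, comp_add_right_tame (spr_add hG hEG).tame hI hEs.trK.tame, comp_idK_right,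
    comp_add_left_tame hG.tame hEG.tame hEs.trK.tame]
  abel

/-- [folklore] **ONLY THE SLICE-INTERNAL CORRECTOR MEETS THE ROAD's KERNEL (left)**: `E∘G₀ = Ẽ∘G₀`, `Ẽ := E∘axEc ρ_c n` (`G₀ = axEc∘G₀`,
`ChartDefectResolvent.relInv_G0bm_ctr`). -/
theorem comp_E_G0_eq_comp_Etilde_G0 :
    comp (psiKS (ctrOff (d + 1) n) n - idK) (coDressKBmAt (ctr (d + 1) n) n (KInvStep (d := d) n 0))
      = comp (comp (psiKS (ctrOff (d + 1) n) n - idK) (axEc (ctr (d + 1) n) n)) (coDressKBmAt (ctr (d + 1) n) n (KInvStep (d := d) n 0)) := by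
  have hn : 0 < n := Nat.pos_of_ne_zero (NeZero.ne n)
  have hr : ctrOff (d + 1) n ∈ box (d + 1) n := ctrOff_mem_box hn
  have hR := relInv_G0bm_ctr (d := d) (Lc := n)
  conv_lhs => rw [← hR.EA]
  rw [comp_assoc_tame (spr_E hn hr).tame (spr_axEc _ n).tame spr_G0bm_ctr.tame]

/-- [folklore] **(right)**: `G₀∘Eᵀ = G₀∘Ẽᵀ`, `Ẽᵀ = axEc∘Eᵀ` (`G₀ = G₀∘axEc`, `trK_axEc`, `trK_comp`). -/
theorem comp_G0_trK_E_eq_comp_G0_trK_Etilde :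
    comp (coDressKBmAt (ctr (d + 1) n) n (KInvStep (d := d) n 0)) (trK (psiKS (ctrOff (d + 1) n) n - idK))
      = comp (coDressKBmAt (ctr (d + 1) n) n (KInvStep (d := d) n 0)) (trK (comp (psiKS (ctrOff (d + 1) n) n - idK) (axEc (ctr (d + 1) n) n))) := by
  have hn : 0 < n := Nat.pos_of_ne_zero (NeZero.ne n)
  have hr : ctrOff (d + 1) n ∈ box (d + 1) n := ctrOff_mem_box hn
  have hR := relInv_G0bm_ctr (d := d) (Lc := n)
  rw [trK_comp, trK_axEc]
  conv_lhs => rw [← hR.AE]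
  rw [← comp_assoc_tame spr_G0bm_ctr.tame (spr_axEc _ n).tame (spr_E hn hr).trK.tame]

/-- [folklore] **THE LITERAL KERNEL IS THE ROAD's KERNEL CONJUGATED BY THE SLICE-INTERNAL UNIPOTENT `idK + Ẽ`**:
`GcombSh n 0 = (idK + Ẽ)∘G₀∘(idK + Ẽ)ᵀ`, `Ẽ := E∘axEc ρ_c n` — the conjugation of `SymCorrectorTransport.GcombSh_zero_eq_conj_psiKS_KInvStep` may be
performed with a corrector that commutes with the slice projector (§2) and squares to zero. -/
theorem GcombSh_zero_eq_conj_Etilde :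
    GcombSh (d := d) n 0
      = comp (comp (idK + comp (psiKS (ctrOff (d + 1) n) n - idK) (axEc (ctr (d + 1) n) n)) (coDressKBmAt (ctr (d + 1) n) n (KInvStep (d := d) n 0)))
          (trK (idK + comp (psiKS (ctrOff (d + 1) n) n - idK) (axEc (ctr (d + 1) n) n))) := by
  have hn : 0 < n := Nat.pos_of_ne_zero (NeZero.ne n)
  have hr : ctrOff (d + 1) n ∈ box (d + 1) n := ctrOff_mem_box hn
  set E : MKer (d + 1) (Fib d) := psiKS (ctrOff (d + 1) n) n - idK with hE
  set Et : MKer (d + 1) (Fib d) := comp E (axEc (ctr (d + 1) n) n) with hEt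
  set G₀ : MKer (d + 1) (Fib d) := coDressKBmAt (ctr (d + 1) n) n (KInvStep (d := d) n 0) with hG₀
  have hI : Tame (idK : MKer (d + 1) (Fib d)) := spr_idK.tame
  have hEts : Spr Et := spr_comp (spr_E hn hr) (spr_axEc _ n)
  have hG : Spr G₀ := spr_G0bm_ctr
  have hEG : Spr (comp Et G₀) := spr_comp hEts hG
  -- expand the right-hand side into the four `Ẽ`-words
  rw [trK_add, trK_idK, comp_add_left_tame hI hEts.tame hG.tame, comp_idK_left,
    comp_add_right_tame (spr_add hG hEG).tame hI hEts.trK.tame, comp_idK_right, comp_add_left_tame hG.tame hEG.tame hEts.trK.tame]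
  -- the four `E`-words, with `E ↦ Ẽ` next to `G₀`
  have h := GcombSh_zero_eq_E_words (d := d) n
  have h1 := comp_E_G0_eq_comp_Etilde_G0 (d := d) n
  have h2 := comp_G0_trK_E_eq_comp_G0_trK_Etilde (d := d) n
  rw [← hE, ← hG₀] at h h1 h2
  rw [← hEt] at h1 h2
  have hTE : Tame (trK E) := (spr_E hn hr).trK.tame
  have hTEt : Tame (trK Et) := hEts.trK.tame
  have h3 : comp (comp E G₀) (trK E) = comp (comp Et G₀) (trK Et) := by
    rw [h1, ← comp_assoc_tame hEts.tame hG.tame hTE, h2, comp_assoc_tame hEts.tame hG.tame hTEt]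
  rw [h, h3, h1, h2]
  abel

end Pins

end Summit.QuantumFields.BalabanUV.Beta.D1BFx.ChartDefectCorrectorWords

end
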